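/-
Copyright (c) 2026 the pub-hodgecm-mathlib formalisation cell (harness21).  Prover seat hodgecm-mathlib-K2Liu-p12 (g0): Track B «K2-LIT»,
#184♮ = hLiu418 = stmt-HodgeConjecture-24832; Road Φ of socket #41, organ Φ4 «unramified local coefficient» (LEAD F0P6-plan (g13) ruling «M-157k»), file X2.
-/
import Summits.HodgeConjecture.HodgeConjecture.Theorems.K2LiuGoodPlaceLeviSupply          -- ★ U1′: `isIntegralAt_of_mball_zero`; brings ★ `weylDelta_mul_nElem_mem_localInt`, ball letter
import Summits.HodgeConjecture.HodgeConjecture.Theorems.K2LiuSkewLatticeShells           -- ★ F3b (K2Liu-p08): balls of `S`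
import Mathlib.MeasureTheory.Integral.Bochner.Set
import HarnessLib

/-!
# Crux `HLiu418`, Road Φ of socket #41, organ Φ4 — FILE X2: THE UNIT-BALL CONTRIBUTION TO THE UNRAMIFIED WHITTAKER COEFFICIENT IS THE VOLUME

Cell `hodgecm-mathlib`, crux item hLiu418 = `stmt-HodgeConjecture-24832`, route of record `HCCMUnconditional`; squad K2 ∕ K2Liu, road `K2_Liu`,
socket #41 `sig_K2LiuSiegelEisensteinContinuation`, Road Φ, organ Φ4 = «(R-bound) + the one exact value» (ruling M-157k; census
`K2/K2Liu-p12/g0/CENSUS-PHI4-UnramifiedLocalCoefficient.K2Liu-p12-g0.md` §2).  THEOREMS ONLY (no `def`, no `instance`, no `notation`, no named-fact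
hypothesis, no `sorry`); lane `--supports stmt-HodgeConjecture-24832` (count-neutral helper; closes no socket by itself).

WHAT.  The `m = 0` stratum of every road to the exact unimodular value `W°_{β,v}(1,s) = (1 − q_v^{−(2s+1)})(1 − ε(ϖ_v)q_v^{−(2s+2)})`: at a good place
(`|2|_w = 1` for all `w ∣ v`), for a SPHERICAL section `φ` of `I_v(s,χ_v)` (★ `IsSphericalSection`), an additive character `ψ_v` of conductor exponent
`d ≤ 0` and an INTEGRAL Fourier index `β` (`β ∈ ball(0)`), the integrand `φ(w_Δ n(t))·ψ_v(−τ tr(β t))` is IDENTICALLY `1` on the unit ball `B(0)` of the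
skew lattice (`w_Δ n(t) ∈ K_v` by ★ `weylDelta_mul_nElem_mem_localInt`; `τ tr(β t) ∈ 𝒪_v ⊆ 𝔭_v^d` by ★ `tau_mem_primePowBall`), so
  **`∫_{B(0)} φ(w_Δ n(t)) ψ_v(−τ tr(β t)) dμ(t) = μ(B(0))`.**
With ★ `K2LiuGoodPlaceWhittakerBound.goodPlace_whittaker_setIntegral_ball_eq` (radius `K(β) = 3` for unimodular `β` off `2δ`·cond(ψ)) the exact value is
`μ(B(0)) + Σ_{k=1}^{3} ∫_{B(−k)∖B(−k+1)}`, three shell sums — the remaining (E-Gauss) computation.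

## References
* [Casselman1980] W. Casselman, Compositio Math. 40 (1980), §3.   * [Shimura1997] G. Shimura, CBMS 93 (1997), §13, §18–§19.
* [KudlaRallis1994] S. Kudla, S. Rallis, Ann. of Math. 140 (1994), §2.
-/

set_option autoImplicit false
-- the mandated namespace repeats the single-problem summit's segment (`HodgeConjecture.HodgeConjecture`)
set_option linter.dupNamespace false

noncomputable section

open scoped NNReal ENNReal Matrix Topology ValuativeRel
open NumberField IsDedekindDomain Matrix MeasureTheory Set
open Literature.NumberTheory.Automorphic Literature.NumberTheory.Automorphic.UnitaryGroup
open Literature.NumberTheory.GelbartRogawski1991.AdaptedBlocks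
open Literature.NumberTheory.GelbartRogawski1991.UnitaryDualPair.LocalSplitting
open Literature.NumberTheory.K2Lit.LocalSiegelDoubled
open Summit.HodgeConjecture.HodgeConjecture.Cruxes.HLiu418.K2LiuLocalRingValuationBalls
open Summit.HodgeConjecture.HodgeConjecture.Cruxes.HLiu418.K2LiuGoodPlaceLeviSupply
open Summit.HodgeConjecture.HodgeConjecture.Cruxes.HLiu418.K2LiuSiegelWeylUnipotentIwasawa
open Summit.HodgeConjecture.HodgeConjecture.Cruxes.HLiu418.K2LiuSkewLatticeShells

namespace Summit.HodgeConjecture.HodgeConjecture.Cruxes.HLiu418.K2LiuGoodPlaceWhittakerUnitBall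

variable (F : Type) [Field F] [NumberField F] (E : Type) [Field E] [NumberField E] [Algebra F E]
  [Algebra.IsQuadraticExtension F E] (c : E ≃ₐ[F] E)
  {δ : E} (hcδ : c δ = -δ) (hδ : δ ≠ 0) {dd : F} (hd : δ * δ = algebraMap F E dd)
  (v : HeightOneSpectrum (𝓞 F)) (n : ℕ) {T₀ : Matrix (Fin n) (Fin n) F} (hT₀ : T₀.IsSymm)
  {JD : Matrix (Fin (n + n)) (Fin (n + n)) E} (hJD : JD = (gramD F n T₀).map (algebraMap F E))
  {π : v.adicCompletion F} (hπ : Valued.v π = WithZero.exp (-1 : ℤ))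

include hcδ hδ hd hT₀ hJD hπ in
/-- **the integrand is `1` on the unit ball**: for `t ∈ B(0)`, `φ(w_Δ n(t)) = 1` (spherical `φ`, `w_Δ n(t) ∈ K_v`) and `ψ_v(−τ tr(β t)) = 1` (`β` integral,
conductor exponent `d ≤ 0`). [cite: Casselman1980, §3] [cite: Shimura1997, §18] -/
theorem integrand_eq_one_of_mem_unitBall
    (S : AddSubgroup (Matrix (Fin n) (Fin n) (LocalRing E v)))
    (hS : ∀ t, t ∈ S ↔ (t.map (conjLocal E c v))ᵀ * gramS F E v n T₀ + gramS F E v n T₀ * t = 0)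
    (h2v : ∀ w : PlacesOver E v, ValuativeRel.valuation (w.1.adicCompletion E) (2 : w.1.adicCompletion E) = 1)
    {χv : ∀ w : PlacesOver E v, (w.1.adicCompletion E)ˣ →* ℂˣ} {s : ℂ} {φ : UnitaryGroup.localPi E c (n + n) JD v → ℂ}
    (hφ : IsSphericalSection F E c hcδ hδ hd v n hT₀ hJD χv s φ)
    {ψ : AddChar (v.adicCompletion F) Circle} {d : ℤ} (hdψ : ψ.HasConductorExp d) (hd0 : d ≤ 0)
    {τ : LocalRing E v → v.adicCompletion F} (hτ : ∀ r, toLocalRing E v (τ r) = r + conjLocal E c v r)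
    {β : Matrix (Fin n) (Fin n) (LocalRing E v)} (hβ : ∀ i j (w : PlacesOver E v), Valued.v (β i j w) ≤ Valued.v (toPlace v w π) ^ (0 : ℤ))
    (t : S) (ht : ∀ i j (w : PlacesOver E v), Valued.v (t.1 i j w) ≤ Valued.v (toPlace v w π) ^ (0 : ℤ)) :
    φ (weylDelta F E c v n hJD * nElem F E c v n hJD t.1 ((hS t.1).1 t.2)) * ((ψ (-τ (Matrix.trace (β * t.1))) : Circle) : ℂ) = 1 := by
  have h1 : φ (weylDelta F E c v n hJD * nElem F E c v n hJD t.1 ((hS t.1).1 t.2)) = 1 :=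
    hφ.apply_of_mem_localInt (weylDelta_mul_nElem_mem_localInt F E c v n hJD t.1 ((hS t.1).1 t.2) h2v fun w => isIntegralAt_of_mball_zero F E v ht w)
  have hmem : -τ (Matrix.trace (β * t.1)) ∈ primePowBall (v.adicCompletion F) d := by
    refine primePowBall_antitone hd0 (neg_mem_primePowBall ?_)
    have h := tau_mem_primePowBall F E c v hπ hτ (ball_trace F E v (mball_mul F E v hπ hβ ht))
    rwa [show (0 : ℤ) + 0 = 0 by ring] at h
  rw [h1, hdψ.1 _ hmem, one_mul, Circle.coe_one]

include hcδ hδ hd hT₀ hJD hπ in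
/-- **THE UNIT-BALL CONTRIBUTION IS THE VOLUME**: `∫_{B(0)} φ(w_Δ n(t)) ψ_v(−τ tr(β t)) dμ = μ(B(0))` at a good place, for a spherical `φ`, `ψ_v` of
conductor exponent `d ≤ 0` and an integral `β`. [cite: Casselman1980, §3] [cite: Shimura1997, §18–§19] [cite: KudlaRallis1994, §2] -/
theorem setIntegral_unitBall_eq_measureReal
    (S : AddSubgroup (Matrix (Fin n) (Fin n) (LocalRing E v)))
    (hS : ∀ t, t ∈ S ↔ (t.map (conjLocal E c v))ᵀ * gramS F E v n T₀ + gramS F E v n T₀ * t = 0)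
    [MeasurableSpace S] [BorelSpace S] (μ : Measure S)
    (h2v : ∀ w : PlacesOver E v, ValuativeRel.valuation (w.1.adicCompletion E) (2 : w.1.adicCompletion E) = 1)
    {χv : ∀ w : PlacesOver E v, (w.1.adicCompletion E)ˣ →* ℂˣ} {s : ℂ} {φ : UnitaryGroup.localPi E c (n + n) JD v → ℂ}
    (hφ : IsSphericalSection F E c hcδ hδ hd v n hT₀ hJD χv s φ)
    {ψ : AddChar (v.adicCompletion F) Circle} {d : ℤ} (hdψ : ψ.HasConductorExp d) (hd0 : d ≤ 0)
    {τ : LocalRing E v → v.adicCompletion F} (hτ : ∀ r, toLocalRing E v (τ r) = r + conjLocal E c v r)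
    {β : Matrix (Fin n) (Fin n) (LocalRing E v)} (hβ : ∀ i j (w : PlacesOver E v), Valued.v (β i j w) ≤ Valued.v (toPlace v w π) ^ (0 : ℤ)) :
    ∫ t in {t : S | ∀ i j (w : PlacesOver E v), Valued.v (t.1 i j w) ≤ Valued.v (toPlace v w π) ^ (0 : ℤ)},
        φ (weylDelta F E c v n hJD * nElem F E c v n hJD t.1 ((hS t.1).1 t.2)) * ((ψ (-τ (Matrix.trace (β * t.1))) : Circle) : ℂ) ∂μ =
      (μ.real {t : S | ∀ i j (w : PlacesOver E v), Valued.v (t.1 i j w) ≤ Valued.v (toPlace v w π) ^ (0 : ℤ)} : ℂ) := by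
  rw [setIntegral_congr_fun (measurableSet_ball F E v hπ n S 0)
    (fun t ht => integrand_eq_one_of_mem_unitBall F E c hcδ hδ hd v n hT₀ hJD hπ S hS h2v hφ hdψ hd0 hτ hβ t ht), setIntegral_const, Complex.real_smul, mul_one]

end Summit.HodgeConjecture.HodgeConjecture.Cruxes.HLiu418.K2LiuGoodPlaceWhittakerUnitBall

end
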